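import Literature.Topology.FourManifolds.WeaklyReducibleTrisections
import Literature.Topology.FourManifolds.SurfaceCircleSweep
import Literature.Topology.FourManifolds.CollarTheorem
import Literature.Topology.FourManifolds.DiffeotopyProofs
import Literature.Geometry.Manifold.SmoothEmbeddingInverse
import HarnessLib

/-!
# Sweeping one round circle of an annular chart of `h(∂H)` onto another by a diffeomorphism of `H`

Helper file (`--supports stmt-SmoothPoincare4-18000`, stub `stub_boundsDisc_of_annularChart` of
the registered skeleton `Cruxes/DependentTripleGenusThreeStandard/Lines/Sketch.lean`, Aux2).

Let `h : H → M` be a smooth embedding of a compact smooth `3`-manifold with boundary into a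
smooth `4`-manifold, and `ψ : ℝ² → M` a plane map which on an open round annulus
`A = {r_lo < ‖x‖ < r_hi}` is smooth, injective, immersive INTO `M`, with `ψ(A) ⊆ h(∂H)`.  Then for
radii `r_lo < r₀, r₁ < r_hi` (positive) there is a diffeomorphism `Φ` of `H` preserving `∂H`
(setwise) with `Φ (h⁻¹ (ψ (r₀ x))) = h⁻¹ (ψ (r₁ x))` for every unit vector `x`
(`helper_exists_diffeomorph_sweep_of_annularChart`, REGISTERED helper).  Road, all inputs proved
in the tree:

* the chart is transferred to the abstract closed surface `∂H`
  (`BoundaryManifold.boundaryData 2 H`: the subtype `∂H` with its boundary charts, inclusion a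
  smooth embedding): `ψ_N = (Subtype.val)⁻¹ ∘ h⁻¹ ∘ ψ` is smooth on `A` because inverses of smooth
  embeddings are smooth on their ranges (`Literature.Geometry.Manifold.contMDiffOn_invFun_range`),
  injective, and immersive by the chain rule applied to `ψ = h ∘ val ∘ ψ_N`;
* `SurfaceCircleSweep.exists_ambientIsotopy_sweep_circle_of_annulus` sweeps the `r₀`-circle onto
  the `r₁`-circle by an ambient isotopy `Ψ` of the compact surface `∂H`;
* its end map is diffeotopic to the identity (`AmbientIsotopy.isDiffeotopicToId`), hence extends
  to a diffeomorphism `Φ` of `H` with `Φ ∘ val = val ∘ Ψ₁`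
  (`BoundaryData.diffeoExtends_of_isDiffeotopicToId_holds`: collar theorem, Hirsch Ch. 8 §2).

No definitions, no named facts.

References: M. W. Hirsch, *Differential Topology* (1976), Ch. 8 §1 Thm. 1.3, §2 Thm. 2.3;
J. Milnor, *Lectures on the h-cobordism theorem* (1965), Thm. 5.8; R. Aranda, A. Zupan,
arXiv:2503.04607 (2025), §7 p. 24 (configuration (1)), Remark 2.1.
-/

-- the registered namespace `Summit.SmoothPoincare4.SmoothPoincare4.Theorems…` repeats a component
set_option linter.dupNamespace false

noncomputable section

open scoped Manifold ContDiff Topology ContinuousMap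
open Set Function Metric
open Literature.Topology.FourManifolds
open Literature.Topology.FourManifolds.Trisection

namespace Summit.SmoothPoincare4.SmoothPoincare4.Theorems

/-- **Sweeping a round circle of an annular chart of `h(∂H)` onto another by a diffeomorphism of
`H` preserving `∂H`** (REGISTERED helper of the crux `DependentTripleGenusThreeStandard`, line
`Sketch`; configuration (1) of Aranda–Zupan §7).  See the module docstring for the road.
[cite: HirschDT1976, Ch. 8 §1 Thm. 1.3 and Ch. 8 §2 proof of Thm. 2.3]
[cite: ArandaZupan2025, §7 (p. 24), configuration (1); Remark 2.1 (p. 3)] -/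
theorem helper_exists_diffeomorph_sweep_of_annularChart :
    ∀ (M : Type) [TopologicalSpace M] [T2Space M] [SecondCountableTopology M]
      [ChartedSpace (EuclideanSpace ℝ (Fin 4)) M] [IsManifold (𝓡 4) ∞ M]
      (H : Type) [TopologicalSpace H] [ChartedSpace (EuclideanHalfSpace 3) H]
      [IsManifold (𝓡∂ 3) ∞ H] [CompactSpace H] [Nonempty H]
      (h : H → M), Manifold.IsSmoothEmbedding (𝓡∂ 3) (𝓡 4) ∞ h →
      ∀ (ψ : EuclideanSpace ℝ (Fin 2) → M) (rlo r₀ r₁ rhi : ℝ),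
      0 < r₀ → 0 < r₁ → rlo < r₀ → rlo < r₁ → r₀ < rhi → r₁ < rhi →
      ContMDiffOn (𝓡 2) (𝓡 4) ∞ ψ {x | rlo < ‖x‖ ∧ ‖x‖ < rhi} →
      Set.InjOn ψ {x | rlo < ‖x‖ ∧ ‖x‖ < rhi} →
      (∀ x : EuclideanSpace ℝ (Fin 2), rlo < ‖x‖ → ‖x‖ < rhi →
        Function.Injective (mfderiv (𝓡 2) (𝓡 4) ψ x)) →
      ψ '' {x | rlo < ‖x‖ ∧ ‖x‖ < rhi} ⊆ h '' (𝓡∂ 3).boundary H →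
      ∃ Φ : Diffeomorph (𝓡∂ 3) (𝓡∂ 3) H H ∞,
        Φ '' (𝓡∂ 3).boundary H = (𝓡∂ 3).boundary H ∧
        ∀ x : Metric.sphere (0 : EuclideanSpace ℝ (Fin 2)) 1,
          Φ (Function.invFun h (ψ (r₀ • (x : EuclideanSpace ℝ (Fin 2))))) =
            Function.invFun h (ψ (r₁ • (x : EuclideanSpace ℝ (Fin 2)))) := by
  intro M _ _ _ _ _ H _ _ _ _ _ h hh ψ rlo r₀ r₁ rhi h₀ h₁ hlo₀ hlo₁ hhi₀ hhi₁ hs hinj himm hψF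
  haveI : T2Space H := hh.isEmbedding.t2Space
  haveI : SecondCountableTopology H := hh.isEmbedding.secondCountableTopology
  set A : Set (EuclideanSpace ℝ (Fin 2)) := {x | rlo < ‖x‖ ∧ ‖x‖ < rhi} with hA_def
  have hAo : IsOpen A :=
    (isOpen_lt continuous_const continuous_norm).inter (isOpen_lt continuous_norm continuous_const)
  have hnorm : ∀ {c : ℝ}, 0 < c → ∀ x : Metric.sphere (0 : EuclideanSpace ℝ (Fin 2)) 1,
      ‖c • (x : EuclideanSpace ℝ (Fin 2))‖ = c := fun hc x => by
    rw [norm_smul, Real.norm_of_nonneg hc.le, norm_eq_of_mem_sphere x, mul_one]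
  have hmem₀ : ∀ x : Metric.sphere (0 : EuclideanSpace ℝ (Fin 2)) 1,
      r₀ • (x : EuclideanSpace ℝ (Fin 2)) ∈ A := fun x => by
    simp only [hA_def, mem_setOf_eq, hnorm h₀]; exact ⟨hlo₀, hhi₀⟩
  have hmem₁ : ∀ x : Metric.sphere (0 : EuclideanSpace ℝ (Fin 2)) 1,
      r₁ • (x : EuclideanSpace ℝ (Fin 2)) ∈ A := fun x => by
    simp only [hA_def, mem_setOf_eq, hnorm h₁]; exact ⟨hlo₁, hhi₁⟩
  -- the boundary surface `∂H` as an abstract closed surface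
  set bd : BoundaryData (𝓡∂ 3) H (𝓡 2) := BoundaryManifold.boundaryData 2 H with hbd_def
  haveI : CompactSpace bd.carrier := bd.compactSpace_carrier
  haveI : T2Space bd.carrier := bd.isSmoothEmbedding.isEmbedding.t2Space
  have hψA : ∀ z ∈ A, ψ z ∈ h '' (𝓡∂ 3).boundary H := fun z hz => hψF ⟨z, hz, rfl⟩
  haveI : Nonempty bd.carrier := by
    set x₀ : Metric.sphere (0 : EuclideanSpace ℝ (Fin 2)) 1 :=
      ⟨EuclideanSpace.single 0 1, by simp⟩ with hx₀
    obtain ⟨y, hy, -⟩ := hψA _ (hmem₀ x₀)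
    have hy' : y ∈ range bd.incl := by rw [bd.range_incl]; exact hy
    obtain ⟨n, -⟩ := hy'
    exact ⟨n⟩
  -- stage 1: the chart pulled back into `H`
  set ψH : EuclideanSpace ℝ (Fin 2) → H := fun z => invFun h (ψ z) with hψH_def
  have hinvh : ContMDiffOn (𝓡 4) (𝓡∂ 3) ∞ (invFun h) (range h) :=
    Literature.Geometry.Manifold.contMDiffOn_invFun_range hh
  have hhψH : ∀ z ∈ A, h (ψH z) = ψ z := fun z hz => by
    obtain ⟨y, -, hy⟩ := hψA z hz
    exact invFun_eq ⟨y, hy⟩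
  have hψH_bd : ∀ z ∈ A, ψH z ∈ (𝓡∂ 3).boundary H := fun z hz => by
    obtain ⟨y, hy, hyz⟩ := hψA z hz
    have : ψH z = y := hh.isEmbedding.injective (by rw [hhψH z hz, hyz])
    rw [this]; exact hy
  have hψHs : ContMDiffOn (𝓡 2) (𝓡∂ 3) ∞ ψH A :=
    hinvh.comp hs fun z hz => by
      obtain ⟨y, -, hy⟩ := hψA z hz
      exact ⟨y, hy⟩
  -- stage 2: into the abstract surface `∂H`
  set ψN : EuclideanSpace ℝ (Fin 2) → bd.carrier := fun z => invFun bd.incl (ψH z) with hψN_def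
  have hinvi : ContMDiffOn (𝓡∂ 3) (𝓡 2) ∞ (invFun bd.incl) (range bd.incl) :=
    Literature.Geometry.Manifold.contMDiffOn_invFun_range bd.isSmoothEmbedding
  have hψH_range : ∀ z ∈ A, ψH z ∈ range bd.incl := fun z hz => by
    rw [bd.range_incl]; exact hψH_bd z hz
  have hincl : ∀ z ∈ A, bd.incl (ψN z) = ψH z := fun z hz => invFun_eq (hψH_range z hz)
  have hψNs : ContMDiffOn (𝓡 2) (𝓡 2) ∞ ψN A := hinvi.comp hψHs fun z hz => hψH_range z hz
  have hjψN : ∀ z ∈ A, h (bd.incl (ψN z)) = ψ z := fun z hz => by rw [hincl z hz, hhψH z hz]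
  have hinjN : InjOn ψN A := fun z hz w hw heq =>
    hinj hz hw (by rw [← hjψN z hz, ← hjψN w hw]; exact congrArg (fun y => h (bd.incl y)) heq)
  have himmN : ∀ z : EuclideanSpace ℝ (Fin 2), rlo < ‖z‖ → ‖z‖ < rhi →
      Injective (mfderiv (𝓡 2) (𝓡 2) ψN z) := by
    intro z hz1 hz2
    have hz : z ∈ A := ⟨hz1, hz2⟩
    have hev : ψ =ᶠ[𝓝 z] ((fun y => h (bd.incl y)) ∘ ψN) := by
      filter_upwards [hAo.mem_nhds hz] with w hw
      exact (hjψN w hw).symm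
    have h1 : MDifferentiableAt (𝓡 2) (𝓡 2) ψN z :=
      ((hψNs z hz).contMDiffAt (hAo.mem_nhds hz)).mdifferentiableAt (by simp)
    have h2 : MDifferentiableAt (𝓡 2) (𝓡∂ 3) bd.incl (ψN z) :=
      (bd.isSmoothEmbedding.contMDiff _).mdifferentiableAt (by simp)
    have h3 : MDifferentiableAt (𝓡∂ 3) (𝓡 4) h (bd.incl (ψN z)) :=
      (hh.contMDiff _).mdifferentiableAt (by simp)
    have h23 : MDifferentiableAt (𝓡 2) (𝓡 4) (fun y => h (bd.incl y)) (ψN z) := h3.comp _ h2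
    have hcomp : mfderiv (𝓡 2) (𝓡 4) ψ z =
        (mfderiv (𝓡 2) (𝓡 4) (fun y => h (bd.incl y)) (ψN z)).comp
          (mfderiv (𝓡 2) (𝓡 2) ψN z) := by
      rw [hev.mfderiv_eq]
      exact mfderiv_comp z h23 h1
    have key := himm z hz1 hz2
    rw [hcomp] at key
    have key' : Injective ((mfderiv (𝓡 2) (𝓡 4) (fun y => h (bd.incl y)) (ψN z)) ∘
        (mfderiv (𝓡 2) (𝓡 2) ψN z)) := key
    exact key'.of_comp
  -- the sweep on the closed surface `∂H`
  obtain ⟨Ψ, hΨ, -⟩ :=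
    SurfaceCircleSweep.exists_ambientIsotopy_sweep_circle_of_annulus (N := bd.carrier) hψNs hinjN
      himmN h₀ h₁ hhi₀ hhi₁ hlo₀ hlo₁ le_rfl le_rfl isOpen_univ (fun _ _ _ => mem_univ _)
  -- its end map extends to `H`
  have hiso : Diffeomorph.IsDiffeotopicToId (Ψ.toDiffeomorph 1) := Ψ.isDiffeotopicToId 1
  obtain ⟨Φ, hΦ⟩ :=
    BoundaryData.diffeoExtends_of_isDiffeotopicToId_holds 2 H bd (Ψ.toDiffeomorph 1) hiso
  have hΦincl : ∀ y : bd.carrier, Φ (bd.incl y) = bd.incl (Ψ.toFun 1 y) := fun y => by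
    have := congr_fun hΦ y
    simpa only [comp_apply, AmbientIsotopy.coe_toDiffeomorph] using this
  refine ⟨Φ, ?_, fun x => ?_⟩
  · rw [← bd.range_incl]
    apply Subset.antisymm
    · rintro _ ⟨_, ⟨y, rfl⟩, rfl⟩
      exact ⟨Ψ.toFun 1 y, (hΦincl y).symm⟩
    · rintro _ ⟨y, rfl⟩
      obtain ⟨y', hy'⟩ := (Ψ.bijective 1).2 y
      exact ⟨bd.incl y', ⟨y', rfl⟩, by rw [hΦincl, hy']⟩
  · have e₀ : invFun h (ψ (r₀ • (x : EuclideanSpace ℝ (Fin 2)))) =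
        bd.incl (ψN (r₀ • (x : EuclideanSpace ℝ (Fin 2)))) := (hincl _ (hmem₀ x)).symm
    have e₁ : invFun h (ψ (r₁ • (x : EuclideanSpace ℝ (Fin 2)))) =
        bd.incl (ψN (r₁ • (x : EuclideanSpace ℝ (Fin 2)))) := (hincl _ (hmem₁ x)).symm
    rw [e₀, e₁, hΦincl, hΨ x]

end Summit.SmoothPoincare4.SmoothPoincare4.Theorems

end
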